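import Summits.QuantumFields.GaugeBoot.Rows.KZL2rpD4BlkDefs
import Summits.QuantumFields.GaugeBoot.Rows.KZL2rpD4Lines
import Summits.QuantumFields.GaugeBoot.Rows.SymIrrH10
import Summits.QuantumFields.GaugeBoot.Rows.SymIrrH11
import Summits.QuantumFields.GaugeBoot.Rows.SymIrrH12
import Summits.QuantumFields.GaugeBoot.Rows.SymIrrH6
import Summits.QuantumFields.GaugeBoot.Rows.SymIrrH9
import HarnessLib

/-!
# Gauge-boot: kernel check of the orbit tables, part 3/5 (blocks 17–21)

Cell `pub-gaugeboot` (HOME `run/shared/lean/pub/pub-gaugeboot/`), seat lean1 (SYMMETRY-FACTORISED torus layer for the kz-L2-rp-4D family =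
rows C91–C106 / C123–C127; label set, lines, irrep data, pair/row class certification, orbit tables, reduction identity, assembly).

HONEST FRAMING (page 1 of every file of this cell): certified bounds on lattice expectations at STATED coupling,
gauge group, dimension and torus size; NOT a mass gap, NOT a continuum limit, NOT a string tension, NOT large `N`.
The venture is explicitly NOT Yang–Mills-summit-bearing (barriers `FixedCouplingUltralocality`,
`PerturbativeInvisibility`).

For each listed block `k`: `∀ j t, t·(row line of column j) = orbit line (k, j, t)` where `t` runs over the support codes of the block's
irrep (`SymIrr.tc…`) — `decide +kernel` over nested shallow ranges (one `gactT` evaluation per entry), then the `Fin` form `orb_ok_k`.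
-/

noncomputable section

open Literature.MathematicalPhysics.QuantumFieldTheory

namespace Summit.QuantumFields.GaugeBoot

namespace KZL2rpD4

set_option maxHeartbeats 0 in
/-- Orbit table of block 17 (`H/irrep10(d2,c-)`, 10 columns × 768 support codes; kernel, nested ranges). -/
theorem orb_okN_17 : ∀ j : Fin 10, ∀ x : Fin 24, ∀ z : Fin 32, 0 + 32 * x.val + z.val < 768 → SymB4.gactT (SymIrr.tcH10 (0 + 32 * x.val + z.val)) (Sn (rowLineH (hRow 17 j.val).val)) = Sn (orbH 17 j.val (0 + 32 * x.val + z.val)).val := by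
  decide +kernel

/-- Orbit table of block 17, `Fin` form. -/
theorem orb_ok_17 (j : Fin 10) (t : Fin 768) : SymB4.gactT (SymIrr.tcH10 t.val) (Sn (rowLineH (hRow 17 j.val).val)) = Sn (orbH 17 j.val t.val).val :=
  SymB4.nested_elim (P := fun t => SymB4.gactT (SymIrr.tcH10 t) (Sn (rowLineH (hRow 17 j.val).val)) = Sn (orbH 17 j.val t).val) (lo := 0) (hi := 768) (A := 24) (B := 32) (by norm_num) (orb_okN_17 j) t.val (Nat.zero_le _) t.isLt

set_option maxHeartbeats 0 in
/-- Orbit table of block 18 (`H/irrep16(d3,c-)`, 18 columns × 768 support codes; kernel, nested ranges). -/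
theorem orb_okN_18 : ∀ j : Fin 18, ∀ x : Fin 24, ∀ z : Fin 32, 0 + 32 * x.val + z.val < 768 → SymB4.gactT (SymIrr.tcH16 (0 + 32 * x.val + z.val)) (Sn (rowLineH (hRow 18 j.val).val)) = Sn (orbH 18 j.val (0 + 32 * x.val + z.val)).val := by
  decide +kernel

/-- Orbit table of block 18, `Fin` form. -/
theorem orb_ok_18 (j : Fin 18) (t : Fin 768) : SymB4.gactT (SymIrr.tcH16 t.val) (Sn (rowLineH (hRow 18 j.val).val)) = Sn (orbH 18 j.val t.val).val :=
  SymB4.nested_elim (P := fun t => SymB4.gactT (SymIrr.tcH16 t) (Sn (rowLineH (hRow 18 j.val).val)) = Sn (orbH 18 j.val t).val) (lo := 0) (hi := 768) (A := 24) (B := 32) (by norm_num) (orb_okN_18 j) t.val (Nat.zero_le _) t.isLt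

set_option maxHeartbeats 0 in
/-- Orbit table of block 19 (`H/irrep17(d3,c-)`, 16 columns × 768 support codes; kernel, nested ranges). -/
theorem orb_okN_19 : ∀ j : Fin 16, ∀ x : Fin 24, ∀ z : Fin 32, 0 + 32 * x.val + z.val < 768 → SymB4.gactT (SymIrr.tcH17 (0 + 32 * x.val + z.val)) (Sn (rowLineH (hRow 19 j.val).val)) = Sn (orbH 19 j.val (0 + 32 * x.val + z.val)).val := by
  decide +kernel

/-- Orbit table of block 19, `Fin` form. -/
theorem orb_ok_19 (j : Fin 16) (t : Fin 768) : SymB4.gactT (SymIrr.tcH17 t.val) (Sn (rowLineH (hRow 19 j.val).val)) = Sn (orbH 19 j.val t.val).val :=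
  SymB4.nested_elim (P := fun t => SymB4.gactT (SymIrr.tcH17 t) (Sn (rowLineH (hRow 19 j.val).val)) = Sn (orbH 19 j.val t).val) (lo := 0) (hi := 768) (A := 24) (B := 32) (by norm_num) (orb_okN_19 j) t.val (Nat.zero_le _) t.isLt

set_option maxHeartbeats 0 in
/-- Orbit table of block 20 (`H/irrep24(d4,c-)`, 19 columns × 192 support codes; kernel, nested ranges). -/
theorem orb_okN_20 : ∀ j : Fin 19, ∀ x : Fin 6, ∀ z : Fin 32, 0 + 32 * x.val + z.val < 192 → SymB4.gactT (SymIrr.tcH24 (0 + 32 * x.val + z.val)) (Sn (rowLineH (hRow 20 j.val).val)) = Sn (orbH 20 j.val (0 + 32 * x.val + z.val)).val := by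
  decide +kernel

/-- Orbit table of block 20, `Fin` form. -/
theorem orb_ok_20 (j : Fin 19) (t : Fin 192) : SymB4.gactT (SymIrr.tcH24 t.val) (Sn (rowLineH (hRow 20 j.val).val)) = Sn (orbH 20 j.val t.val).val :=
  SymB4.nested_elim (P := fun t => SymB4.gactT (SymIrr.tcH24 t) (Sn (rowLineH (hRow 20 j.val).val)) = Sn (orbH 20 j.val t).val) (lo := 0) (hi := 192) (A := 6) (B := 32) (by norm_num) (orb_okN_20 j) t.val (Nat.zero_le _) t.isLt

set_option maxHeartbeats 0 in
/-- Orbit table of block 21 (`H/irrep25(d4,c-)`, 11 columns × 192 support codes; kernel, nested ranges). -/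
theorem orb_okN_21 : ∀ j : Fin 11, ∀ x : Fin 6, ∀ z : Fin 32, 0 + 32 * x.val + z.val < 192 → SymB4.gactT (SymIrr.tcH25 (0 + 32 * x.val + z.val)) (Sn (rowLineH (hRow 21 j.val).val)) = Sn (orbH 21 j.val (0 + 32 * x.val + z.val)).val := by
  decide +kernel

/-- Orbit table of block 21, `Fin` form. -/
theorem orb_ok_21 (j : Fin 11) (t : Fin 192) : SymB4.gactT (SymIrr.tcH25 t.val) (Sn (rowLineH (hRow 21 j.val).val)) = Sn (orbH 21 j.val t.val).val :=
  SymB4.nested_elim (P := fun t => SymB4.gactT (SymIrr.tcH25 t) (Sn (rowLineH (hRow 21 j.val).val)) = Sn (orbH 21 j.val t).val) (lo := 0) (hi := 192) (A := 6) (B := 32) (by norm_num) (orb_okN_21 j) t.val (Nat.zero_le _) t.isLt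

end KZL2rpD4

end Summit.QuantumFields.GaugeBoot

end
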